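import Summits.AtomisticToContinuum.HydrodynamicLimit.Theorems.CollisionIsometryCLTMacroClosureEngineFlowMeasurable
import Summits.AtomisticToContinuum.HydrodynamicLimit.Theorems.CollisionIsometryCLTMacroClosureEngineClassical
import Summits.AtomisticToContinuum.HydrodynamicLimit.Theorems.CollisionIsometryCLTMacroClosureStubClausiusLimits
import Summits.AtomisticToContinuum.HydrodynamicLimit.Theses.StiffCollisionalRelaxation
import HarnessLib

/-!
# Sub-goal `engine_jointMeasurable` of the lead's `engine_incrementBound` (line `IdeatorTwoGen1Sketch`,
# crux `MacroClosure`, stmt-AtomisticToContinuum-14870): joint measurability of the good-event relative entropy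

Support file (`--supports stmt-AtomisticToContinuum-14870`) landing the registered sub-goal
`Barycentric.engine_jointMeasurable` (S3 of the increment bound): the good-event block relative-entropy functional
`F(τ, z) = 𝟙_G(z) ∫ₓ h_σ(Ū(φ, Φ_τ z, x) | U_cl(τ, x)) dx` is a.e.-strongly measurable in `(τ, z)` for the product
of Lebesgue measure on `[0, t]` and a finite law `μ` carried by the good set (the input of the Tonelli step
`E[𝟙_G ∫₀ˢ X_τ dτ] = ∫₀ˢ E[𝟙_G X_τ] dτ`).

Proof (namespace `Barycentric.EngineJointMeasurable`).
* CLAMP. On `[0, t] × G` every block of `Φ_τ z` lies in the band `c₁ ≤ ρ̄ ≤ σ⁻³`, where the density clamp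
  `clamp V = (max c₁ (min V.1 σ⁻³), V.2)` is the identity (`Clausius.clamp_eq_of_band`), and the time clamp
  `c τ = max 0 (min τ t)` is the identity; so `F` agrees, at every `(τ, z)` with `τ ∈ [0, t]` (a conull set for
  the restricted product measure), with `F̃(τ, z) = 𝟙_G(z) ∫ₓ g((τ, Φ_τ z), x) dx`,
  `g((τ, w), x) = η_σ(clamp Ū(w, x)) − η_σ(U_cl(cτ, x)) − Λ_cl(cτ, x)(clamp Ū(w, x) − U_cl(cτ, x))`.
* JOINT BOREL MEASURABILITY of `g` on `(ℝ × Config) × 𝕋³` (`measurable_integrand`): `(w, x) ↦ clamp Ū(w, x)` is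
  measurable and `U ↦ η_σ(clamp U)` is measurable (`Clausius.measurable_clampU`,
  `Clausius.measurable_hsEntropy_clamp`; Ruelle continuity of `f_ex` on `[c₁σ³, 1]` from `HsFreeEnergyConvex`,
  `Clausius.continuousOn_hsExcessFreeEnergy`); `(τ, x) ↦ U_cl(cτ, x)`, `η_σ(U_cl(cτ, x))`, `Λ_cl(cτ, x)` are
  CONTINUOUS on `ℝ × 𝕋³` (`continuous_timeClamp`: joint smoothness on `[0, T) ⊇ [0, t]` — the solution fields,
  clause 1 of `ThermoChamber` composed with `U_cl` in the chamber, clause 3 for `Λ_cl` — descends along the open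
  quotient map `ℝ × ℝ³ → ℝ × 𝕋³`); the pairing `(L, V) ↦ L V` is continuous. Hence
  `(τ, w) ↦ ∫ₓ g((τ, w), x) dx` is measurable (`StronglyMeasurable.integral_prod_right'`).
* COMPOSE with the a.e.-measurable flow `(τ, z) ↦ (τ, Φ_τ z)` (`engine_flowMeasurable`, `μ goodᶜ = 0`), restrict
  to `[0, t] × Config` (`Measure.restrict_prod_eq_prod_univ`), multiply by the indicator of the measurable
  cylinder `ℝ × G`, and transfer along the a.e. equality `F = F̃`.
-/

noncomputable section

open MeasureTheory Filter Set Topology InformationTheory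
open scoped ENNReal ContDiff

namespace Summit.AtomisticToContinuum.HydrodynamicLimit.Theorems.MacroClosureLine

open Literature.MathematicalPhysics.KineticTheory Literature.Analysis.FluidPDE
open Literature.Analysis.FunctionSpaces
open Summit.AtomisticToContinuum.HydrodynamicLimit.Theses

namespace Barycentric

namespace EngineJointMeasurable

/-! ## Time clamp and continuity of clamped smooth fields on `ℝ × 𝕋³` -/

/-- The time clamp `c τ = max 0 (min τ t)` takes values in `[0, T)` when `0 ≤ t < T`. -/
theorem timeClamp_mem {t T : ℝ} (ht : 0 ≤ t) (htT : t < T) (τ : ℝ) : max 0 (min τ t) ∈ Ico 0 T :=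
  ⟨le_max_left _ _, (max_le ht (min_le_right _ _)).trans_lt htT⟩

/-- The time clamp is the identity on `[0, t]`. -/
theorem timeClamp_of_mem {t τ : ℝ} (hτ : τ ∈ Icc 0 t) : max 0 (min τ t) = τ := by
  rw [min_eq_left hτ.2, max_eq_right hτ.1]

/-- **A field jointly smooth on the time set `S`, evaluated at a continuously clamped time `c τ ∈ S`, is
jointly continuous on `ℝ × 𝕋³`**: continuity of the space–time lift on `S × ℝ³` descends along the open
quotient map `ℝ × ℝ³ → ℝ × 𝕋³`. -/
theorem continuous_timeClamp {F : Type*} [NormedAddCommGroup F] [NormedSpace ℝ F] {S : Set ℝ}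
    {f : ℝ → T3 → F} (hf : Torus.IsSmoothSpaceTimeOn S f) {c : ℝ → ℝ} (hc : Continuous c)
    (hcS : ∀ τ, c τ ∈ S) : Continuous fun p : ℝ × T3 => f (c p.1) p.2 := by
  have hq : IsOpenQuotientMap (Prod.map id Torus.proj : ℝ × V3 → ℝ × T3) :=
    IsOpenQuotientMap.id.prodMap Torus.isOpenQuotientMap_proj
  have hlift : Continuous fun p : ℝ × V3 => (c p.1, p.2) := by fun_prop
  exact hq.continuous_comp_iff.1
    (hf.continuousOn_stLift.comp_continuous hlift fun p => mk_mem_prod (hcS p.1) (mem_univ _))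

/-! ## Joint measurability of the clamped relative-entropy integrand -/

section Integrand

variable {σ η₃ T : ℝ} {ρ θ : ℝ → T3 → ℝ} {u : ℝ → T3 → V3}

/-- **The clamped relative-entropy integrand is jointly Borel measurable** on `(ℝ × Config) × 𝕋³`:
`((τ, w), x) ↦ η_σ(clamp Ū(w,x)) − η_σ(U_cl(cτ, x)) − Λ_cl(cτ, x)(clamp Ū(w,x) − U_cl(cτ, x))` with the density
clamp `clamp V = (max c₁ (min V.1 σ⁻³), V.2)` and the time clamp `cτ = max 0 (min τ t)`. -/
theorem measurable_integrand (hσ : 0 < σ) (hTC : ThermoChamber η₃) (hE : IsHardSphereEulerSolution σ T ρ u θ)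
    (hpack : ∀ s ∈ Ico 0 T, ∀ x, ρ s x * σ ^ 3 < η₃) {t : ℝ} (ht : 0 ≤ t) (htT : t < T) {c₁ : ℝ}
    (hc₁σ : c₁ * σ ^ 3 ≤ 1) (hfex : ContinuousOn hsExcessFreeEnergy (Icc (c₁ * σ ^ 3) 1)) (N : ℕ)
    {φ : T3 → ℝ} (hφc : Continuous φ) :
    Measurable fun q : (ℝ × Config (N + 1) (Fin 3) T3) × T3 =>
      hsEntropy σ ((max c₁ (min (bρ φ q.1.2 q.2) (σ ^ 3)⁻¹), bm φ q.1.2 q.2, bE φ q.1.2 q.2) : State) -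
        hsEntropy σ (Ucl ρ θ u (max 0 (min q.1.1 t)) q.2) -
        Lcl σ ρ θ u (max 0 (min q.1.1 t)) q.2
          (((max c₁ (min (bρ φ q.1.2 q.2) (σ ^ 3)⁻¹), bm φ q.1.2 q.2, bE φ q.1.2 q.2) : State) -
            Ucl ρ θ u (max 0 (min q.1.1 t)) q.2) := by
  have hcm : ∀ τ, max 0 (min τ t) ∈ Ico 0 T := fun τ => timeClamp_mem ht htT τ
  have hcc : Continuous fun τ : ℝ => max 0 (min τ t) := by fun_prop
  -- clauses 1 and 3 of `ThermoChamber`: smoothness of `η_σ` on the chamber and of `Λ_cl` on `[0, T)`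
  have hη : ContDiffOn ℝ ∞ (hsEntropy σ) (chamber σ η₃) := (hTC σ hσ).1.1
  obtain ⟨hΛ0, -, -, -⟩ := (hTC σ hσ).2.2 T ρ θ u hE hpack
  have hΛ : Torus.IsSmoothSpaceTimeOn (Ico 0 T) (Lcl σ ρ θ u) := hΛ0
  have hU : Torus.IsSmoothSpaceTimeOn (Ico 0 T) (Ucl ρ θ u) := EngineClassical.isSmoothSpaceTimeOn_Ucl hE
  have hηU : Torus.IsSmoothSpaceTimeOn (Ico 0 T) (fun s x => hsEntropy σ (Ucl ρ θ u s x)) :=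
    EngineClassical.isSmoothSpaceTimeOn_comp_Ucl hη hE hpack
  -- the classical pieces are continuous, hence measurable, in `(τ, x)` after the time clamp
  have hL1 : Measurable fun p : ℝ × T3 => Lcl σ ρ θ u (max 0 (min p.1 t)) p.2 :=
    (continuous_timeClamp hΛ hcc hcm).measurable
  have hU1 : Measurable fun p : ℝ × T3 => Ucl ρ θ u (max 0 (min p.1 t)) p.2 :=
    (continuous_timeClamp hU hcc hcm).measurable
  have hη1 : Measurable fun p : ℝ × T3 => hsEntropy σ (Ucl ρ θ u (max 0 (min p.1 t)) p.2) :=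
    (continuous_timeClamp hηU hcc hcm).measurable
  have hπ : Measurable fun q : (ℝ × Config (N + 1) (Fin 3) T3) × T3 => (q.1.1, q.2) :=
    measurable_fst.fst.prodMk measurable_snd
  have hLm : Measurable fun q : (ℝ × Config (N + 1) (Fin 3) T3) × T3 =>
      Lcl σ ρ θ u (max 0 (min q.1.1 t)) q.2 := hL1.comp hπ
  have hUm : Measurable fun q : (ℝ × Config (N + 1) (Fin 3) T3) × T3 =>
      Ucl ρ θ u (max 0 (min q.1.1 t)) q.2 := hU1.comp hπ
  have hηm : Measurable fun q : (ℝ × Config (N + 1) (Fin 3) T3) × T3 =>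
      hsEntropy σ (Ucl ρ θ u (max 0 (min q.1.1 t)) q.2) := hη1.comp hπ
  -- measurability of the clamped block state and of its entropy
  have hwx : Measurable fun q : (ℝ × Config (N + 1) (Fin 3) T3) × T3 => (q.1.2, q.2) :=
    measurable_fst.snd.prodMk measurable_snd
  have hb := (Clausius.measurable_bU_prod hφc).comp hwx
  have hρm : Measurable fun q : (ℝ × Config (N + 1) (Fin 3) T3) × T3 => bρ φ q.1.2 q.2 := hb.fst
  have hmm : Measurable fun q : (ℝ × Config (N + 1) (Fin 3) T3) × T3 => bm φ q.1.2 q.2 := hb.snd.fst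
  have hEm : Measurable fun q : (ℝ × Config (N + 1) (Fin 3) T3) × T3 => bE φ q.1.2 q.2 := hb.snd.snd
  have hV : Measurable fun q : (ℝ × Config (N + 1) (Fin 3) T3) × T3 =>
      ((max c₁ (min (bρ φ q.1.2 q.2) (σ ^ 3)⁻¹), bm φ q.1.2 q.2, bE φ q.1.2 q.2) : State) :=
    (measurable_const.max (hρm.min measurable_const)).prodMk (hmm.prodMk hEm)
  have hηV : Measurable fun q : (ℝ × Config (N + 1) (Fin 3) T3) × T3 =>
      hsEntropy σ ((max c₁ (min (bρ φ q.1.2 q.2) (σ ^ 3)⁻¹), bm φ q.1.2 q.2, bE φ q.1.2 q.2) : State) :=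
    (Clausius.measurable_hsEntropy_clamp hσ hc₁σ hfex).comp ((Clausius.measurable_bU_prod hφc).comp hwx)
  -- the pairing `(L, V) ↦ L V` is continuous
  have hW : Measurable fun q : (ℝ × Config (N + 1) (Fin 3) T3) × T3 =>
      (((max c₁ (min (bρ φ q.1.2 q.2) (σ ^ 3)⁻¹), bm φ q.1.2 q.2, bE φ q.1.2 q.2) : State) -
        Ucl ρ θ u (max 0 (min q.1.1 t)) q.2) := hV.sub hUm
  have hev : Continuous fun r : (State →L[ℝ] ℝ) × State => r.1 r.2 := isBoundedBilinearMap_apply.continuous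
  have hpair : Measurable fun q : (ℝ × Config (N + 1) (Fin 3) T3) × T3 =>
      Lcl σ ρ θ u (max 0 (min q.1.1 t)) q.2
        (((max c₁ (min (bρ φ q.1.2 q.2) (σ ^ 3)⁻¹), bm φ q.1.2 q.2, bE φ q.1.2 q.2) : State) -
          Ucl ρ θ u (max 0 (min q.1.1 t)) q.2) :=
    hev.measurable.comp (hLm.prodMk hW)
  exact (hηV.sub hηm).sub hpair

end Integrand

end EngineJointMeasurable

/-! ## The sub-goal -/

/-- **`engine_jointMeasurable` (S3 of `engine_incrementBound`): joint measurability of the good-event block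
relative entropy.** For a classical solution in the chamber of `ThermoChamber η₃`, `0 < t < T`, a continuous kernel,
a finite law `μ` carried by the good set of the flow `Φ` and a measurable good event `G ⊆ good` whose images along
`[0, t]` lie in the band `c₁ ≤ ρ̄ ≤ σ⁻³`, the functional
`(τ, z) ↦ 𝟙_G(z) ∫ₓ h_σ(Ū(φ, Φ_τ z, x) | U_cl(τ, x)) dx` is a.e.-strongly measurable for `vol|[0,t] ⊗ μ`
(clamp in density and time, joint Borel measurability of the clamped integrand, parametric integral, composition
with the a.e.-measurable flow). -/
theorem engine_jointMeasurable : ∀ (σ : ℝ), 0 < σ → StiffCollisionalRelaxation.HsFreeEnergyConvex → ∀ (T : ℝ) (ρ θ : ℝ → T3 → ℝ) (u : ℝ → T3 → V3), IsHardSphereEulerSolution σ T ρ u θ → ∀ η₃ : ℝ, ThermoChamber η₃ → (∀ s ∈ Ico 0 T, ∀ x, ρ s x * σ ^ 3 < η₃) → ∀ t : ℝ, 0 < t → t < T → ∀ c₁ : ℝ, 0 < c₁ → c₁ * σ ^ 3 ≤ 1 → ∀ (N : ℕ) (Φ : Flow σ N) (φ : T3 → ℝ), Continuous φ → ∀ (μ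 : Measure (Config (N + 1) (Fin 3) T3)) [IsFiniteMeasure μ], μ (Φ.good)ᶜ = 0 → ∀ G : Set (Config (N + 1) (Fin 3) T3), MeasurableSet G → G ⊆ Φ.good → (∀ z ∈ G, ∀ τ ∈ Icc 0 t, ∀ x, c₁ ≤ bρ φ (Φ.flow τ z) x ∧ bρ φ (Φ.flow τ z) x * σ ^ 3 ≤ 1) → AEStronglyMeasurable (fun p : ℝ × Config (N + 1) (Fin 3) T3 => G.indicator (fun z => ∫ x, relEnt σ (bU φ (Φ.flow p.1 z) x) (Ucl ρ θ u p.1 x)) p.2) ((volume.restrict (Icc 0 t)).prod μ) := by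
  intro σ hσ hH T ρ θ u hE η₃ hTC hpack t ht htT c₁ hc₁ hc₁σ N Φ φ hφc μ _ hμ G hGm _ hGband
  -- Ruelle continuity of `f_ex` on the band packings `[c₁σ³, 1] ⊆ (0, 11/10)`
  have hfex : ContinuousOn hsExcessFreeEnergy (Icc (c₁ * σ ^ 3) 1) :=
    (Clausius.continuousOn_hsExcessFreeEnergy hH).mono fun r hr =>
      ⟨(mul_pos hc₁ (pow_pos hσ 3)).trans_le hr.1, hr.2.trans_lt (by norm_num)⟩
  -- the clamped integrand `g` and its parametric integral
  set g : (ℝ × Config (N + 1) (Fin 3) T3) × T3 → ℝ := fun q =>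
    hsEntropy σ ((max c₁ (min (bρ φ q.1.2 q.2) (σ ^ 3)⁻¹), bm φ q.1.2 q.2, bE φ q.1.2 q.2) : State) -
      hsEntropy σ (Ucl ρ θ u (max 0 (min q.1.1 t)) q.2) -
      Lcl σ ρ θ u (max 0 (min q.1.1 t)) q.2
        (((max c₁ (min (bρ φ q.1.2 q.2) (σ ^ 3)⁻¹), bm φ q.1.2 q.2, bE φ q.1.2 q.2) : State) -
          Ucl ρ θ u (max 0 (min q.1.1 t)) q.2) with hg_def
  have hg : Measurable g :=
    EngineJointMeasurable.measurable_integrand hσ hTC hE hpack ht.le htT hc₁σ hfex N hφc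
  have hI : Measurable fun p : ℝ × Config (N + 1) (Fin 3) T3 => ∫ x, g (p, x) :=
    (hg.stronglyMeasurable.integral_prod_right' (ν := volume)).measurable
  -- on `[0, t] × G` the clamps are invisible: `g((τ, Φ_τ z), x) = h_σ(Ū(Φ_τ z, x) | U_cl(τ, x))`
  have hkey : ∀ τ ∈ Icc 0 t, ∀ z ∈ G, ∀ x,
      g ((τ, Φ.flow τ z), x) = relEnt σ (bU φ (Φ.flow τ z) x) (Ucl ρ θ u τ x) := by
    intro τ hτ z hz x
    obtain ⟨h1, h2⟩ := hGband z hz τ hτ x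
    have hcl : ((max c₁ (min (bρ φ (Φ.flow τ z) x) (σ ^ 3)⁻¹), bm φ (Φ.flow τ z) x, bE φ (Φ.flow τ z) x) :
        State) = bU φ (Φ.flow τ z) x :=
      Clausius.clamp_eq_of_band (U := bU φ (Φ.flow τ z) x) hσ h1 h2
    simp only [hg_def]
    rw [hcl, EngineJointMeasurable.timeClamp_of_mem hτ]
    rfl
  -- compose with the a.e.-measurable flow and restrict to `[0, t] × Config`
  have hΨ : AEMeasurable (fun p : ℝ × Config (N + 1) (Fin 3) T3 => (p.1, Φ.flow p.1 p.2))
      ((volume : Measure ℝ).prod μ) :=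
    measurable_fst.aemeasurable.prodMk (engine_flowMeasurable σ N Φ μ hμ)
  have hIΨ : AEMeasurable (fun p : ℝ × Config (N + 1) (Fin 3) T3 => ∫ x, g ((p.1, Φ.flow p.1 p.2), x))
      ((volume : Measure ℝ).prod μ) :=
    hI.comp_aemeasurable hΨ
  have hrestr : (volume.restrict (Icc 0 t)).prod μ =
      (((volume : Measure ℝ).prod μ).restrict (Icc 0 t ×ˢ univ)) :=
    Measure.restrict_prod_eq_prod_univ (Icc 0 t)
  have hIΨ' : AEStronglyMeasurable
      (fun p : ℝ × Config (N + 1) (Fin 3) T3 => ∫ x, g ((p.1, Φ.flow p.1 p.2), x))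
      ((volume.restrict (Icc 0 t)).prod μ) := by
    rw [hrestr]
    exact hIΨ.aestronglyMeasurable.restrict
  -- the indicator of the measurable cylinder `ℝ × G`
  have hind : AEStronglyMeasurable (fun p : ℝ × Config (N + 1) (Fin 3) T3 =>
      G.indicator (fun z => ∫ x, g ((p.1, Φ.flow p.1 z), x)) p.2) ((volume.restrict (Icc 0 t)).prod μ) := by
    have heq : (fun p : ℝ × Config (N + 1) (Fin 3) T3 =>
        G.indicator (fun z => ∫ x, g ((p.1, Φ.flow p.1 z), x)) p.2) =
        (Prod.snd ⁻¹' G).indicator (fun p => ∫ x, g ((p.1, Φ.flow p.1 p.2), x)) := by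
      funext p
      by_cases hz : p.2 ∈ G
      · rw [indicator_of_mem hz, indicator_of_mem (show p ∈ Prod.snd ⁻¹' G from hz)]
      · rw [indicator_of_notMem hz, indicator_of_notMem (show p ∉ Prod.snd ⁻¹' G from hz)]
    rw [heq]
    exact hIΨ'.indicator (measurable_snd hGm)
  -- `τ ∈ [0, t]` almost everywhere for the restricted product measure
  have hae : ∀ᵐ p ∂((volume.restrict (Icc 0 t)).prod μ), p.1 ∈ Icc 0 t := by
    rw [hrestr]
    filter_upwards [ae_restrict_mem (measurableSet_Icc.prod MeasurableSet.univ)] with p hp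
    exact (mem_prod.1 hp).1
  -- transfer along the a.e. equality `F̃ = F`
  refine hind.congr ?_
  filter_upwards [hae] with p hp
  by_cases hz : p.2 ∈ G
  · rw [indicator_of_mem hz, indicator_of_mem hz]
    exact integral_congr_ae (Eventually.of_forall fun x => hkey p.1 hp p.2 hz x)
  · rw [indicator_of_notMem hz, indicator_of_notMem hz]

end Barycentric

end Summit.AtomisticToContinuum.HydrodynamicLimit.Theorems.MacroClosureLine

end
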